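import Literature.NumberTheory.GaloisRepresentations.HeckeCharacterModulusExponentProofs
import Literature.NumberTheory.GaloisRepresentations.HeckeLFunctionAnalyticProofs
import Literature.NumberTheory.GaloisRepresentations.AlgebraicHeckeCharacterNormValues
import Literature.NumberTheory.LFunctions.RayClassOfIdealHom
import HarnessLib

/-!
# The value at `s = 0` of the Hecke `L`-function of a character of exponent `σ > 1`
# (negative weight `≤ −3`): the entire continuation is the convergent Dirichlet series there

Topic `NumberTheory/GaloisRepresentations`; namespace
`Literature.NumberTheory.GaloisRepresentations.HeckeCharacter`. Proof file (theorems only; no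
definition, no named fact, no instance), sequel of `HeckeCharacterModulusExponentProofs.lean`
(`χ = χ₀·‖·‖^σ`, `L(χ, s) = L(χ₀, s + σ)` — Weil, *Basic Number Theory* VII §7) and
`HeckeLFunctionAnalyticProofs.lean` (`L(χ₀, s)` holomorphic on `re s > 1` for unitary `χ₀`).

MOTIVATION (de Shalit 1987, II.4.14 (36) / II.4.11 (29); the tree's `DeShalit1987.interpolationValue`,
binder (T4) `hL : LFunction.HasEntireContinuation (heckeLFunction ε)`, `Lval := hL.continuation 0`): for a
grossencharacter `ε` of type `(k, j)`, `0 ≤ −j < k`, the right side of (36) is the value `L_𝔣(ε⁻¹, 0)` of a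
Dirichlet series `Σ ε⁻¹(𝔞) N𝔞^{−s}` whose coefficients grow like `N𝔞^{−(k+j)/2}`; for `k + j ≥ 3` it
CONVERGES ABSOLUTELY at `s = 0`, and "`L(ε⁻¹, 0)`" simply means its sum (this is how the tree's
`EisensteinNumbersPartialHeckeL` / `EisensteinKroneckerNumbersPartialHeckeL` produce it, from II.3.5
(13)). This file proves that the tree's `Lval = hL.continuation 0` IS that sum.

## Statements (for `χ : HeckeCharacter K` of exponent `σ`: `|χ(x)| = ‖x‖^σ` for all ideles `x`)

* `heckeLFunction_hasSum_rayClassCoeff_of_norm_eq_rpow` / `heckeLFunction_eq_rayClassLSeries_of_norm_eq_rpow`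
  — for `re s > 1 − σ` and a modulus `𝔪 ≠ 0` cutting out exactly the ramified places,
  **`L(χ, s) = Σ_𝔞 χ̃(𝔞) N𝔞^{−s} = rayClassLSeries 𝔪 (χ(ϖ_·)) s`** as a CONVERGENT series (Euler product
  of the unitary part at `s + σ`, `re > 1`, Neukirch VII (8.1), and `χ₀(ϖ_v) = χ(ϖ_v)N(v)^σ`);
* `differentiableOn_heckeLFunction_of_norm_eq_rpow` — `L(χ, ·)` is holomorphic on `re s > 1 − σ`;
* ★ `continuation_eq_heckeLFunction_of_norm_eq_rpow` — for `σ ≥ 0`, any entire continuation `g` of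
  `L(χ, ·)` (agreement on `re s > 1`) agrees with it on `re s > 1 − σ` (identity theorem,
  `LFunctions.eqOn_halfPlane_of_eqOn`);
* ★★ `continuation_zero_eq_rayClassLSeries_zero`, `hasSum_rayClassCoeff_continuation_zero` — for
  `σ > 1`: **`hL.continuation 0 = Σ_𝔞 χ̃(𝔞)`** (sum over the nonzero ideals prime to `𝔪`, convergent);
* (appended §5) `rayClassLSeries_eq_mul_prod_of_norm_eq_rpow` (change of modulus on `re s > 1 − σ`) and
  ★★ `rayClassLSeries_mul_zero_eq_prod_mul_continuation_zero` — the IMPRIMITIVE series at `0`: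
  `L_{𝔪₁𝔪₂}(χ, 0) = ∏_{𝔭∣𝔪₂, 𝔭∤𝔪₁}(1 − χ(ϖ_𝔭))·hL.continuation 0` (de Shalit's `L_𝔣 = ∏_{w∣𝔣}(1 − ε(w))·L`, II.4.12 (32));
* `norm_apply_eq_ideleNorm_rpow_of_hasInfinityType` — the exponent of an algebraic character of
  infinity type `(p, q)` and weight `w` (`2(p_v + q_v) = w·[K_v:ℝ]`) is `σ = −w/2` (from the tree's
  `HasInfinityType.norm_valueAtUniformizer_sq`, `|χ(ϖ_v)|² = Nv^w`, at one place off the module of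
  definition); so for de Shalit's type `(−m, j)` over an imaginary quadratic field `σ = (m − j)/2`, and
  `σ > 1` iff `m − j ≥ 3`.

References: A. Weil, *Basic Number Theory* (1967), Ch. VII §7 [WeilBNT1967]; J. Neukirch, *Algebraic
Number Theory* (1999), Ch. VII §8 (8.1) [NeukirchANT1999]; E. de Shalit (1987), II.4.14 (36) (p. 71),
II.3.5 (13) (p. 54) [deShalit1987].

Mathlib / tree search: tree `HeckeCharacter.exists_isUnitary_mul_of_norm_eq_rpow`,
`heckeLFunction_eq_unitaryPart_translate`, `isUnramifiedAt_iff_unitaryPart`, `valueAtUniformizer_unitaryPart`,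
`norm_valueAtUniformizer_unitaryPart`, `norm_valueAtUniformizer_of_norm_eq_rpow`,
`differentiableOn_heckeLFunction`, `LFunctions.hasSum_rayClassLSeries`, `LFunctions.rayClassLSeries_eq_tprod`,
`LFunctions.eqOn_halfPlane_of_eqOn`, `LFunctions.idealPow_apply_asIdeal`, `GrossencharakterAlgebra.idealPow_mul_fun'`
(not imported: restated privately), `HasInfinityType.norm_valueAtUniformizer_sq`;
`lean search 'continuation.*heckeLFunction.*0|heckeLFunction_eq_rayClassLSeries'`: only the unitary case
(`heckeLFunction_eq_rayClassLSeries_of_isUnitary`, `re s > 1`).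
-/

noncomputable section

open scoped ComplexConjugate
open NumberField IsDedekindDomain Complex
open Literature.NumberTheory.LFunctions

namespace Literature.NumberTheory.GaloisRepresentations

namespace HeckeCharacter

variable {K : Type} [Field K] [NumberField K]

/-! ### §1. Coefficients: `χ₀(ϖ_v) = χ(ϖ_v)·N(v)^σ` on ideals -/

/-- `(ψ₁ψ₂)~(𝔞) = ψ̃₁(𝔞)ψ̃₂(𝔞)` (the tree's `idealPow_mul_fun'`, restated to keep the imports light).
[cite: NeukirchANT1999, Ch. VII §6 Def. (6.8)] -/
private theorem idealPow_mul_fun_aux (ψ₁ ψ₂ : HeightOneSpectrum (𝓞 K) → ℂ) {I : Ideal (𝓞 K)} (hI : I ≠ ⊥) :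
    idealPow K (fun v ↦ ψ₁ v * ψ₂ v) I = idealPow K ψ₁ I * idealPow K ψ₂ I := by
  unfold idealPow
  rw [← finprod_mul_distrib (mulSupport_idealPow_finite ψ₁ hI) (mulSupport_idealPow_finite ψ₂ hI)]
  exact finprod_congr fun v ↦ mul_pow _ _ _

/-- **`(v ↦ N(v)^z)~(𝔞) = N𝔞^z`**: the complex power of the absolute norm is a character of the monoid
of ideals (`N(𝔞𝔟) = N𝔞·N𝔟`, `(xy)^z = x^z y^z` for `x, y ≥ 0`). [cite: NeukirchANT1999, Ch. III §1 (multiplicativity of the absolute norm)] -/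
theorem idealPow_absNorm_cpow (z : ℂ) {I : Ideal (𝓞 K)} (hI : I ≠ ⊥) :
    idealPow K (fun v ↦ ((Ideal.absNorm v.asIdeal : ℕ) : ℂ) ^ z) I = ((Ideal.absNorm I : ℕ) : ℂ) ^ z := by
  let f : Ideal (𝓞 K) →* ℂ :=
    { toFun := fun J ↦ ((Ideal.absNorm J : ℕ) : ℂ) ^ z
      map_one' := by simp
      map_mul' := fun J J' ↦ by
        simp only [map_mul, Nat.cast_mul]
        rw [show ((Ideal.absNorm J : ℕ) : ℂ) = ((Ideal.absNorm J : ℝ) : ℂ) by norm_cast,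
          show ((Ideal.absNorm J' : ℕ) : ℂ) = ((Ideal.absNorm J' : ℝ) : ℂ) by norm_cast,
          Complex.mul_cpow_ofReal_nonneg (Nat.cast_nonneg _) (Nat.cast_nonneg _)] }
  exact idealPow_apply_asIdeal f hI

/-- **The `L`-series coefficients of the unitary part**: if `χ = χ₀·ν` with `ν = ‖·‖^σ`, then on every
ideal `rayClassCoeff 𝔪 (χ₀(ϖ_·)) 𝔞 = rayClassCoeff 𝔪 (χ(ϖ_·)) 𝔞 · N𝔞^σ` (both vanish off the nonzero
ideals prime to `𝔪`). [cite: WeilBNT1967, Ch. VII §7 (first paragraph)] -/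
theorem rayClassCoeff_unitaryPart {χ χ₀ ν : HeckeCharacter K} {σ : ℝ}
    (hν : ∀ x : ideleGroup K, ((ν x : ℂˣ) : ℂ) = ((ideleNorm x : ℝ) : ℂ) ^ (σ : ℂ))
    (h : χ = χ₀ * ν) (𝔪 : Ideal (𝓞 K)) (I : Ideal (𝓞 K)) :
    rayClassCoeff 𝔪 (fun v ↦ χ₀.valueAtUniformizer v) I =
      rayClassCoeff 𝔪 (fun v ↦ χ.valueAtUniformizer v) I * ((Ideal.absNorm I : ℕ) : ℂ) ^ (σ : ℂ) := by
  classical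
  unfold rayClassCoeff
  by_cases hI : I ≠ ⊥ ∧ IsCoprime I 𝔪
  · rw [if_pos hI, if_pos hI]
    have hfun : (fun v ↦ χ₀.valueAtUniformizer v) =
        fun v ↦ χ.valueAtUniformizer v * ((Ideal.absNorm v.asIdeal : ℕ) : ℂ) ^ (σ : ℂ) :=
      funext fun v ↦ valueAtUniformizer_unitaryPart hν h v
    rw [hfun, idealPow_mul_fun_aux _ _ hI.1, idealPow_absNorm_cpow _ hI.1]
  · rw [if_neg hI, if_neg hI, zero_mul]

/-! ### §2. `L(χ, s)` as a convergent Dirichlet series on `re s > 1 − σ` -/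

/-- For a UNITARY character and a modulus cutting out exactly its ramified places, the Euler products
`heckeLFunction` (over the unramified places) and `rayClassLSeries` (over the primes not dividing `𝔪`)
agree on `re s > 1` (Neukirch VII (8.1); the tree's `heckeLFunction_eq_rayClassLSeries_of_isUnitary`,
restated to keep the imports light). [cite: NeukirchANT1999, Ch. VII §8 (8.1) Proposition] -/
private theorem heckeLFunction_eq_rayClassLSeries_unitary {χ : HeckeCharacter K} (hu : χ.IsUnitary)
    {𝔪 : Ideal (𝓞 K)} (h𝔪 : 𝔪 ≠ ⊥)
    (hiff : ∀ v : HeightOneSpectrum (𝓞 K), χ.IsUnramifiedAt v ↔ ¬ 𝔪 ≤ v.asIdeal)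
    {s : ℂ} (hs : 1 < s.re) :
    heckeLFunction χ s = rayClassLSeries 𝔪 (fun v ↦ χ.valueAtUniformizer v) s := by
  rw [rayClassLSeries_eq_tprod h𝔪 (fun v _ ↦ (norm_valueAtUniformizer_of_isUnitary hu v).le) hs,
    heckeLFunction]
  let e : {v : HeightOneSpectrum (𝓞 K) // χ.IsUnramifiedAt v} ≃
      {v : HeightOneSpectrum (𝓞 K) // ¬ 𝔪 ≤ v.asIdeal} := Equiv.subtypeEquivRight fun v ↦ hiff v
  rw [← Equiv.tprod_eq e]
  exact tprod_congr fun v ↦ rfl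

/-- ★ **`L(χ, s) = Σ_𝔞 χ̃(𝔞) N𝔞^{−s}`, a CONVERGENT series for `re s > 1 − σ`**, for a Hecke character of
exponent `σ` (`|χ(x)| = ‖x‖^σ`) and a modulus `𝔪 ≠ 0` with `χ` unramified at `v ⟺ v ∤ 𝔪`: the series
with coefficients `rayClassCoeff 𝔪 (χ(ϖ_·))` (`χ̃(𝔞)` on the nonzero ideals prime to `𝔪`, else `0`) sums
to `heckeLFunction χ s`. Proof: `χ = χ₀·‖·‖^σ`, `L(χ, s) = L(χ₀, s+σ)` (Weil VII §7), Neukirch VII (8.1)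
for the unitary `χ₀` at `re(s+σ) > 1`, and `χ̃₀(𝔞)N𝔞^{−(s+σ)} = χ̃(𝔞)N𝔞^{−s}`.
[cite: WeilBNT1967, Ch. VII §7 (first paragraph)] [cite: NeukirchANT1999, Ch. VII §8 (8.1) Proposition] -/
theorem heckeLFunction_hasSum_rayClassCoeff_of_norm_eq_rpow {χ : HeckeCharacter K} {σ : ℝ}
    (hσ : ∀ x : ideleGroup K, ‖((χ x : ℂˣ) : ℂ)‖ = ideleNorm x ^ σ)
    {𝔪 : Ideal (𝓞 K)} (h𝔪 : 𝔪 ≠ ⊥)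
    (hiff : ∀ v : HeightOneSpectrum (𝓞 K), χ.IsUnramifiedAt v ↔ ¬ 𝔪 ≤ v.asIdeal)
    {s : ℂ} (hs : 1 - σ < s.re) :
    HasSum (fun I : Ideal (𝓞 K) ↦
      rayClassCoeff 𝔪 (fun v ↦ χ.valueAtUniformizer v) I * ((Ideal.absNorm I : ℕ) : ℂ) ^ (-s))
      (heckeLFunction χ s) := by
  classical
  obtain ⟨χ₀, ν, h₀, hν, h⟩ := exists_isUnitary_mul_of_norm_eq_rpow hσ
  have hs' : 1 < (s + σ).re := by simp only [Complex.add_re, Complex.ofReal_re]; linarith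
  have hiff₀ : ∀ v : HeightOneSpectrum (𝓞 K), χ₀.IsUnramifiedAt v ↔ ¬ 𝔪 ≤ v.asIdeal :=
    fun v ↦ (isUnramifiedAt_iff_unitaryPart hν h v).symm.trans (hiff v)
  rw [heckeLFunction_eq_unitaryPart_translate hν h s, heckeLFunction_eq_rayClassLSeries_unitary h₀ h𝔪 hiff₀ hs']
  have hsum := hasSum_rayClassLSeries h𝔪
    (fun v _ ↦ (norm_valueAtUniformizer_unitaryPart hσ hν h v).le) hs'
  -- termwise `χ̃₀(𝔞)N𝔞^{−(s+σ)} = χ̃(𝔞)N𝔞^{−s}`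
  have hfun : (fun I : Ideal (𝓞 K) ↦
      rayClassCoeff 𝔪 (fun v ↦ χ.valueAtUniformizer v) I * ((Ideal.absNorm I : ℕ) : ℂ) ^ (-s)) =
      fun I : Ideal (𝓞 K) ↦ rayClassCoeff 𝔪 (fun v ↦ χ₀.valueAtUniformizer v) I *
        ((Ideal.absNorm I : ℕ) : ℂ) ^ (-(s + σ)) := by
    funext I
    rw [rayClassCoeff_unitaryPart hν h 𝔪 I]
    by_cases hI : I = ⊥
    · subst hI
      rw [rayClassCoeff_bot, zero_mul, zero_mul, zero_mul]
    · have hN : ((Ideal.absNorm I : ℕ) : ℂ) ≠ 0 := by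
        have : Ideal.absNorm I ≠ 0 := by rwa [Ne, Ideal.absNorm_eq_zero_iff]
        exact_mod_cast this
      rw [mul_assoc, ← Complex.cpow_add _ _ hN]
      congr 2
      ring
  rw [hfun]
  exact hsum

/-- **`L(χ, s) = rayClassLSeries 𝔪 (χ(ϖ_·)) s` for `re s > 1 − σ`** (as values; the series converges by
`heckeLFunction_hasSum_rayClassCoeff_of_norm_eq_rpow`). [cite: WeilBNT1967, Ch. VII §7 (first paragraph)] -/
theorem heckeLFunction_eq_rayClassLSeries_of_norm_eq_rpow {χ : HeckeCharacter K} {σ : ℝ}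
    (hσ : ∀ x : ideleGroup K, ‖((χ x : ℂˣ) : ℂ)‖ = ideleNorm x ^ σ)
    {𝔪 : Ideal (𝓞 K)} (h𝔪 : 𝔪 ≠ ⊥)
    (hiff : ∀ v : HeightOneSpectrum (𝓞 K), χ.IsUnramifiedAt v ↔ ¬ 𝔪 ≤ v.asIdeal)
    {s : ℂ} (hs : 1 - σ < s.re) :
    heckeLFunction χ s = rayClassLSeries 𝔪 (fun v ↦ χ.valueAtUniformizer v) s :=
  ((heckeLFunction_hasSum_rayClassCoeff_of_norm_eq_rpow hσ h𝔪 hiff hs).tsum_eq).symm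

/-- **`L(χ, ·)` is holomorphic on `re s > 1 − σ`** for a character of exponent `σ` (it is
`s ↦ L(χ₀, s + σ)` with `χ₀` unitary, holomorphic on `re > 1`). [cite: WeilBNT1967, Ch. VII §7 (first paragraph)] -/
theorem differentiableOn_heckeLFunction_of_norm_eq_rpow {χ : HeckeCharacter K} {σ : ℝ}
    (hσ : ∀ x : ideleGroup K, ‖((χ x : ℂˣ) : ℂ)‖ = ideleNorm x ^ σ) :
    DifferentiableOn ℂ (heckeLFunction χ) {s : ℂ | 1 - σ < s.re} := by
  obtain ⟨χ₀, ν, h₀, hν, h⟩ := exists_isUnitary_mul_of_norm_eq_rpow hσ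
  have hfun : heckeLFunction χ = fun s ↦ heckeLFunction χ₀ (s + σ) :=
    funext fun s ↦ heckeLFunction_eq_unitaryPart_translate hν h s
  rw [hfun]
  refine (differentiableOn_heckeLFunction h₀).comp ((differentiable_id.add_const _).differentiableOn)
    fun s hs ↦ ?_
  simp only [Set.mem_setOf_eq, Complex.add_re, Complex.ofReal_re] at hs ⊢
  linarith

/-! ### §3. The entire continuation on `re s > 1 − σ` and its value at `0` -/

/-- ★ **An entire continuation of `L(χ, ·)` agrees with it on the whole half-plane `re s > 1 − σ`**
(`σ ≥ 0`): both are holomorphic there and they agree on `re s > 1` (identity theorem on a half-plane,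
`LFunctions.eqOn_halfPlane_of_eqOn`). [cite: NeukirchANT1999, Ch. VII §8 (8.1) Proposition] -/
theorem continuation_eq_heckeLFunction_of_norm_eq_rpow {χ : HeckeCharacter K} {σ : ℝ}
    (hσ : ∀ x : ideleGroup K, ‖((χ x : ℂˣ) : ℂ)‖ = ideleNorm x ^ σ) (h0 : 0 ≤ σ)
    (hL : LFunction.HasEntireContinuation (heckeLFunction χ)) {s : ℂ} (hs : 1 - σ < s.re) :
    hL.continuation s = heckeLFunction χ s :=
  eqOn_halfPlane_of_eqOn (θ := 1 - σ) (x₀ := 1) (by linarith)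
    hL.differentiable_continuation.differentiableOn
    (differentiableOn_heckeLFunction_of_norm_eq_rpow hσ)
    (fun _ hs' ↦ hL.continuation_eq hs') hs

/-- ★★ **The value at `0` of the entire continuation of `L(χ, ·)`, for a character of exponent `σ > 1`,
is the convergent series `Σ_𝔞 χ̃(𝔞)`** over the nonzero ideals prime to `𝔪` (`𝔪 ≠ 0` cutting out exactly
the ramified places): `hL.continuation 0 = rayClassLSeries 𝔪 (χ(ϖ_·)) 0`. This is what the binder
`Lval := hL.continuation 0` of the tree's `DeShalit1987.interpolationValue` evaluates to at the weights
`m − j ≥ 3` of de Shalit II.4.14 (36). [cite: deShalit1987, II.4.14 (36) (p. 71)] [cite: WeilBNT1967, Ch. VII §7 (first paragraph)] -/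
theorem continuation_zero_eq_rayClassLSeries_zero {χ : HeckeCharacter K} {σ : ℝ}
    (hσ : ∀ x : ideleGroup K, ‖((χ x : ℂˣ) : ℂ)‖ = ideleNorm x ^ σ) (h1 : 1 < σ)
    {𝔪 : Ideal (𝓞 K)} (h𝔪 : 𝔪 ≠ ⊥)
    (hiff : ∀ v : HeightOneSpectrum (𝓞 K), χ.IsUnramifiedAt v ↔ ¬ 𝔪 ≤ v.asIdeal)
    (hL : LFunction.HasEntireContinuation (heckeLFunction χ)) :
    hL.continuation 0 = rayClassLSeries 𝔪 (fun v ↦ χ.valueAtUniformizer v) 0 := by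
  rw [continuation_eq_heckeLFunction_of_norm_eq_rpow hσ (by linarith) hL
      (by simp only [Complex.zero_re]; linarith),
    heckeLFunction_eq_rayClassLSeries_of_norm_eq_rpow hσ h𝔪 hiff (by simp only [Complex.zero_re]; linarith)]

/-- ★★ **`hL.continuation 0 = Σ_𝔞 χ̃(𝔞)` as a convergent series** (`σ > 1`): the coefficients
`rayClassCoeff 𝔪 (χ(ϖ_·))` alone (no `N𝔞^{−s}`) sum to the value at `0` of the entire continuation.
[cite: deShalit1987, II.4.14 (36) (p. 71)] [cite: WeilBNT1967, Ch. VII §7 (first paragraph)] -/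
theorem hasSum_rayClassCoeff_continuation_zero {χ : HeckeCharacter K} {σ : ℝ}
    (hσ : ∀ x : ideleGroup K, ‖((χ x : ℂˣ) : ℂ)‖ = ideleNorm x ^ σ) (h1 : 1 < σ)
    {𝔪 : Ideal (𝓞 K)} (h𝔪 : 𝔪 ≠ ⊥)
    (hiff : ∀ v : HeightOneSpectrum (𝓞 K), χ.IsUnramifiedAt v ↔ ¬ 𝔪 ≤ v.asIdeal)
    (hL : LFunction.HasEntireContinuation (heckeLFunction χ)) :
    HasSum (fun I : Ideal (𝓞 K) ↦ rayClassCoeff 𝔪 (fun v ↦ χ.valueAtUniformizer v) I)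
      (hL.continuation 0) := by
  have h := heckeLFunction_hasSum_rayClassCoeff_of_norm_eq_rpow hσ h𝔪 hiff (s := 0)
    (by simp only [Complex.zero_re]; linarith)
  rw [continuation_eq_heckeLFunction_of_norm_eq_rpow hσ (by linarith) hL
    (by simp only [Complex.zero_re]; linarith)]
  have hfun : (fun I : Ideal (𝓞 K) ↦ rayClassCoeff 𝔪 (fun v ↦ χ.valueAtUniformizer v) I) =
      fun I : Ideal (𝓞 K) ↦ rayClassCoeff 𝔪 (fun v ↦ χ.valueAtUniformizer v) I *
        ((Ideal.absNorm I : ℕ) : ℂ) ^ (-(0 : ℂ)) := by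
    funext I
    rw [neg_zero, Complex.cpow_zero, mul_one]
  rw [hfun]
  exact h

/-! ### §4. The exponent of an algebraic character from its infinity type -/

/-- **The exponent of an algebraic Hecke character of weight `w` is `−w/2`**: if `χ` has infinity type
`(p, q)` with `2(p_v + q_v) = w·[K_v:ℝ]` at every infinite place and a module of definition `(T, e)`,
and `v₀ ∉ T` is any finite place, then `|χ(x)| = ‖x‖^{−w/2}` for all ideles `x` (the exponent `σ`
exists by Weil VII §3–4; at `v₀`, `|χ(ϖ_{v₀})| = N(v₀)^{−σ}` and `|χ(ϖ_{v₀})|² = N(v₀)^w`). For de Shalit's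
characters of type `(−m, j)` over an imaginary quadratic field (`[K_v:ℝ] = 2`, `w = j − m`) this is
`σ = (m − j)/2`, `> 1` exactly when `m − j ≥ 3`. [cite: Weil1956] [cite: WeilBNT1967, Ch. VII §7 (first paragraph)] -/
theorem norm_apply_eq_ideleNorm_rpow_of_hasInfinityType {χ : HeckeCharacter K}
    {p q : InfinitePlace K → ℤ} {T : Finset (HeightOneSpectrum (𝓞 K))}
    {e : HeightOneSpectrum (𝓞 K) → ℕ} (hinf : χ.HasInfinityType p q) (hmod : IsModulus χ T e)
    {wt : ℤ} (hw : ∀ v : InfinitePlace K, 2 * (p v + q v) = wt * v.mult)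
    {v₀ : HeightOneSpectrum (𝓞 K)} (hv₀ : v₀ ∉ T) (x : ideleGroup K) :
    ‖((χ x : ℂˣ) : ℂ)‖ = ideleNorm x ^ (-(wt : ℝ) / 2) := by
  obtain ⟨σ, hσ⟩ := χ.exists_norm_apply_eq_ideleNorm_rpow
  -- at `v₀`: `N(v₀)^{-2σ} = N(v₀)^{wt}`
  have h1 := norm_valueAtUniformizer_of_norm_eq_rpow hσ v₀
  have h2 := hinf.norm_valueAtUniformizer_sq hmod hw hv₀
  have hq : (1 : ℝ) < ((Ideal.absNorm v₀.asIdeal : ℕ) : ℝ) := by exact_mod_cast v₀.one_lt_residueCard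
  have hq0 : (0 : ℝ) < ((Ideal.absNorm v₀.asIdeal : ℕ) : ℝ) := lt_trans zero_lt_one hq
  rw [h1, ← Real.rpow_natCast, ← Real.rpow_mul hq0.le] at h2
  have h2' : ((Ideal.absNorm v₀.asIdeal : ℕ) : ℝ) ^ (-σ * (2 : ℕ)) =
      ((Ideal.absNorm v₀.asIdeal : ℕ) : ℝ) ^ ((wt : ℤ) : ℝ) := by
    rw [h2, ← Real.rpow_intCast]
  have hexp : -σ * (2 : ℕ) = ((wt : ℤ) : ℝ) := by
    rcases lt_trichotomy (-σ * (2 : ℕ)) (((wt : ℤ) : ℝ)) with hlt | heq | hgt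
    · exact absurd h2' (ne_of_lt ((Real.rpow_lt_rpow_left_iff hq).mpr hlt))
    · exact heq
    · exact absurd h2' (ne_of_gt ((Real.rpow_lt_rpow_left_iff hq).mpr hgt))
  have hσw : σ = -(wt : ℝ) / 2 := by
    have : ((wt : ℤ) : ℝ) = (wt : ℝ) := rfl
    push_cast at hexp
    linarith
  rw [hσ x, hσw]


/-! ### §5. Change of modulus on `re s > 1 − σ`; imprimitive series at `s = 0` (appended)

The lane's moduli `𝔪_M = 𝔤^{M+1}v̄^{M+1}` cut out MORE than the ramified places of `ε` in general, so the
series the Eisenstein numbers produce is the IMPRIMITIVE `L_{𝔪}(ε, 0)`; it differs from the value of the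
continuation by the Euler factors at the unramified primes of `𝔪` (de Shalit II.4.12 (32), II.4.16 (50):
`L_𝔣 = ∏_{w ∣ 𝔣}(1 − ε(w))·L`; Neukirch VII §8 before (8.5)). -/

/-- Translation of the series of the unitary part, ANY modulus: `L_𝔪(χ₀, s + σ) = L_𝔪(χ, s)` as unconditional
sums (termwise `χ̃₀(𝔞)N𝔞^{−(s+σ)} = χ̃(𝔞)N𝔞^{−s}`). [cite: WeilBNT1967, Ch. VII §7 (first paragraph)] -/
theorem rayClassLSeries_unitaryPart_translate {χ χ₀ ν : HeckeCharacter K} {σ : ℝ}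
    (hν : ∀ x : ideleGroup K, ((ν x : ℂˣ) : ℂ) = ((ideleNorm x : ℝ) : ℂ) ^ (σ : ℂ))
    (h : χ = χ₀ * ν) (𝔪 : Ideal (𝓞 K)) (s : ℂ) :
    rayClassLSeries 𝔪 (fun v ↦ χ₀.valueAtUniformizer v) (s + σ) =
      rayClassLSeries 𝔪 (fun v ↦ χ.valueAtUniformizer v) s := by
  unfold rayClassLSeries
  refine tsum_congr fun I ↦ ?_
  rw [rayClassCoeff_unitaryPart hν h 𝔪 I]
  by_cases hI : I = ⊥
  · subst hI
    rw [rayClassCoeff_bot, zero_mul, zero_mul, zero_mul]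
  · have hN : ((Ideal.absNorm I : ℕ) : ℂ) ≠ 0 := by
      have : Ideal.absNorm I ≠ 0 := by rwa [Ne, Ideal.absNorm_eq_zero_iff]
      exact_mod_cast this
    rw [mul_assoc, ← Complex.cpow_add _ _ hN]
    congr 2
    ring

/-- ★ **Change of modulus on `re s > 1 − σ`** for a character of exponent `σ`:
`L_{𝔪₁}(χ, s) = L_{𝔪₁𝔪₂}(χ, s) · ∏_{𝔭 ∣ 𝔪₂, 𝔭 ∤ 𝔪₁} (1 − χ(ϖ_𝔭)N𝔭^{−s})⁻¹` (the tree's `rayClassLSeries_eq_mul_prod`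
for the unitary part at `s + σ`, translated). [cite: NeukirchANT1999, Ch. VII §8, remark before (8.5)] [cite: WeilBNT1967, Ch. VII §7 (first paragraph)] -/
theorem rayClassLSeries_eq_mul_prod_of_norm_eq_rpow {χ : HeckeCharacter K} {σ : ℝ}
    (hσ : ∀ x : ideleGroup K, ‖((χ x : ℂˣ) : ℂ)‖ = ideleNorm x ^ σ)
    {𝔪₁ 𝔪₂ : Ideal (𝓞 K)} (h𝔪₁ : 𝔪₁ ≠ ⊥) (h𝔪₂ : 𝔪₂ ≠ ⊥) {s : ℂ} (hs : 1 - σ < s.re)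
    {S : Finset (HeightOneSpectrum (𝓞 K))}
    (hS : ∀ v, v ∈ S ↔ 𝔪₂ ≤ v.asIdeal ∧ ¬ 𝔪₁ ≤ v.asIdeal) :
    rayClassLSeries 𝔪₁ (fun v ↦ χ.valueAtUniformizer v) s =
      rayClassLSeries (𝔪₁ * 𝔪₂) (fun v ↦ χ.valueAtUniformizer v) s *
        ∏ v ∈ S, (1 - χ.valueAtUniformizer v * ((Ideal.absNorm v.asIdeal : ℕ) : ℂ) ^ (-s))⁻¹ := by
  obtain ⟨χ₀, ν, h₀, hν, h⟩ := exists_isUnitary_mul_of_norm_eq_rpow hσ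
  have hs' : 1 < (s + σ).re := by simp only [Complex.add_re, Complex.ofReal_re]; linarith
  have key := rayClassLSeries_eq_mul_prod h𝔪₁ h𝔪₂ (ψ := fun v ↦ χ₀.valueAtUniformizer v)
    (fun v _ ↦ (norm_valueAtUniformizer_unitaryPart hσ hν h v).le) hs' hS
  rw [rayClassLSeries_unitaryPart_translate hν h, rayClassLSeries_unitaryPart_translate hν h] at key
  rw [key]
  congr 1
  refine Finset.prod_congr rfl fun v _ ↦ ?_
  have hN : ((Ideal.absNorm v.asIdeal : ℕ) : ℂ) ≠ 0 := by
    have : Ideal.absNorm v.asIdeal ≠ 0 := by rw [Ne, Ideal.absNorm_eq_zero_iff]; exact v.ne_bot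
    exact_mod_cast this
  rw [valueAtUniformizer_unitaryPart hν h v, mul_assoc, ← Complex.cpow_add _ _ hN]
  congr 3
  ring

/-- ★★ **The imprimitive series at `s = 0`**: for a character of exponent `σ > 1`, a modulus `𝔪₁ ≠ 0` cutting
out exactly the ramified places and any `𝔪₂ ≠ 0`,
`L_{𝔪₁𝔪₂}(χ, 0) = ∏_{𝔭 ∣ 𝔪₂, 𝔭 ∤ 𝔪₁} (1 − χ(ϖ_𝔭)) · hL.continuation 0` (`|χ(ϖ_𝔭)| = N𝔭^{−σ} < 1`, so the removed
factors are invertible) — de Shalit's `L_𝔣(ε, 0) = ∏_{w∣𝔣}(1 − ε(w))·L(ε, 0)` at the absolutely convergent weights.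
[cite: deShalit1987, II.4.12 (32) and II.4.16 (50)] [cite: NeukirchANT1999, Ch. VII §8, remark before (8.5)] -/
theorem rayClassLSeries_mul_zero_eq_prod_mul_continuation_zero {χ : HeckeCharacter K} {σ : ℝ}
    (hσ : ∀ x : ideleGroup K, ‖((χ x : ℂˣ) : ℂ)‖ = ideleNorm x ^ σ) (h1 : 1 < σ)
    {𝔪₁ 𝔪₂ : Ideal (𝓞 K)} (h𝔪₁ : 𝔪₁ ≠ ⊥) (h𝔪₂ : 𝔪₂ ≠ ⊥)
    (hiff : ∀ v : HeightOneSpectrum (𝓞 K), χ.IsUnramifiedAt v ↔ ¬ 𝔪₁ ≤ v.asIdeal)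
    {S : Finset (HeightOneSpectrum (𝓞 K))}
    (hS : ∀ v, v ∈ S ↔ 𝔪₂ ≤ v.asIdeal ∧ ¬ 𝔪₁ ≤ v.asIdeal)
    (hL : LFunction.HasEntireContinuation (heckeLFunction χ)) :
    rayClassLSeries (𝔪₁ * 𝔪₂) (fun v ↦ χ.valueAtUniformizer v) 0 =
      (∏ v ∈ S, (1 - χ.valueAtUniformizer v)) * hL.continuation 0 := by
  have key := rayClassLSeries_eq_mul_prod_of_norm_eq_rpow hσ h𝔪₁ h𝔪₂ (s := 0)
    (by simp only [Complex.zero_re]; linarith) hS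
  simp only [neg_zero, Complex.cpow_zero, mul_one] at key
  have hne : ∀ v ∈ S, (1 - χ.valueAtUniformizer v) ≠ 0 := by
    intro v _ h0
    have hq : (1 : ℝ) < ((Ideal.absNorm v.asIdeal : ℕ) : ℝ) := by exact_mod_cast v.one_lt_residueCard
    have hlt : ‖χ.valueAtUniformizer v‖ < 1 := by
      rw [norm_valueAtUniformizer_of_norm_eq_rpow hσ v]
      exact Real.rpow_lt_one_of_one_lt_of_neg hq (by linarith)
    rw [sub_eq_zero] at h0
    rw [← h0, norm_one] at hlt
    exact lt_irrefl _ hlt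
  have hP : ∏ v ∈ S, (1 - χ.valueAtUniformizer v) ≠ 0 := Finset.prod_ne_zero_iff.mpr hne
  rw [continuation_zero_eq_rayClassLSeries_zero hσ h1 h𝔪₁ hiff hL, key, Finset.prod_inv_distrib,
    mul_left_comm, mul_inv_cancel₀ hP, mul_one]

end HeckeCharacter

end Literature.NumberTheory.GaloisRepresentations

end
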